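import Summits.CriticalPhenomena.Ising3D.TaylorTableDecidable
import HarnessLib

/-!
# (g2) TABLE smoke test: a toy `TaylorTable` through `check`, `checkEncl` and `boxExcluded_of_taylorTable_dec` in the kernel
(cell `pub-ising3x`, seat boot-1 gen 6; de-risking the first real table: the assembled Boolean layer COMPUTES on a concrete
structure value by `decide +kernel`)

HONEST FRAMING: lottery ticket; floor = tightest certified 3D Ising CFT bounds; no exact-solution
claim without a proof. THIS IS NOT A CERTIFICATE: the toy functional (one Taylor weight `c₀(1,0) = -1`) excludes
nothing — its region hypotheses `TaylorEvenRegion` / `OddCone` are false and stay hypotheses below; the thresholds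
`E₀ = 3/5`, `E_T = 1/2` make every head cell vacuous. What IS shown: `TaylorTable.check` (basic admissibility, the three
power enclosures by `PowEncl.check`, the identity kd-certificate, covers by `chainCovers`, canonical head sets by
`canonOK`, the per-cell kd checks) and `TaylorTable.checkEncl` evaluate to `true` in the kernel on a concrete table,
and `boxExcluded_of_taylorTable_dec` then consumes them — the plumbing a real certificate will use.
-/

namespace Summit.CriticalPhenomena.Ising3D

open Set Literature.MathematicalPhysics.QuantumFieldTheory.ConformalBootstrap3D Literature.Analysis.ValidatedNumerics

/-- The toy table: box `[0.518, 0.5183] × [1.599, 1.601]`, one weight `c₀(1,0) = -1` (identity polynomial `4Δσ`),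
no majorant, vacuous head cells (an `ε`-row even cell and a `σ`-row odd cell with empty head lists). [folklore] -/
def toyTable : TaylorTable where
  c := fun k ab => if k = 0 ∧ ab = (1, 0) then -1 else 0
  L := [(1, 0)]
  ψ := fun _ => 0
  Lψ := []
  κ₀ := 1
  σlo := 518 / 1000
  σhi := 5183 / 10000
  εlo := 1599 / 1000
  εhi := 1601 / 1000
  E₀ := 3 / 5
  E_T := 1 / 2
  LE := 0
  LT := 0
  κ := ⟨27 / 25, 217 / 200, 47 / 100, 12 / 25⟩
  μσ := ⟨-26 / 25, -103 / 100, 2, 21 / 10⟩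
  με := ⟨-321 / 100, -319 / 100, 9, 19 / 2⟩
  tI := .leaf 20
  bI := -1
  evenCells := [⟨0, 1599 / 1000, 1601 / 1000, [], [], .leaf 1, .leaf 1, .leaf 1⟩]
  oddCells := [⟨0, 518 / 1000, 5183 / 10000, [], [], .leaf 1⟩]

/-- The decidable part of the toy table passes (kernel). -/
example : toyTable.check = true := by decide +kernel

/-- The decidable coefficient-enclosure check of the toy table passes (kernel; vacuously — empty head lists). -/
example : toyTable.checkEncl = true := by decide +kernel

/-- The assembled table theorem consumes the two kernel verdicts; the REGION hypotheses remain (and are NOT true for this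
toy functional — smoke test of the plumbing only). -/
example (hR : TaylorEvenRegion toyTable.α toyTable.box ((toyTable.E₀ : ℚ) : ℝ)) (hC : toyTable.OddCone) :
    BoxExcluded toyTable.box :=
  toyTable.boxExcluded_of_taylorTable_dec (by decide +kernel) (by decide +kernel) hR hC

end Summit.CriticalPhenomena.Ising3D
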